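import Literature.AnabelianGeometry.SemiGraphs.TemperedCompletionExtension
import Literature.GroupTheory.ProfiniteSubquotients
import HarnessLib

/-!
# Profinite completions: the kernel of a completed surjection is the closure of the kernel
# ("the kernel of `Δ̂_X ↠ Π̂_𝔾` is topologically generated by its intersection with `Δ^tp_X`")

Mochizuki, *Semi-graphs of anabelioids*, Publ. RIMS **42** (2006) [SemiAnbd], §6 p. 69 ("we shall denote
the profinite completion of a group by means of a `∧`"; the completed admissible quotients
`Δ_X ↠ Π̂_𝔾` of Ex. 3.10 p. 45) [cite: MochizukiSemiAnbd2006, §6 p.69; Ex 3.10 p.45]; the statement is the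
RIGHT EXACTNESS of profinite completion (Ribes–Zalesskii, *Profinite Groups*, Prop. 3.2.5 / Lemma 3.2.6
[cite: RibesZalesskii2010, Prop 3.2.5]), in the interface form the abc-iut cell uses
(`IsProfiniteCompletion`, `TemperedAnabelian.lean`).

PROOF-ONLY (abc-iut cell, prover abc-iut-w4-d058; generic input of the [IUTchI] Cor. 2.3 (ii) merge atom
"`Ker(Δ̂_X ↠ Π̂_𝔾) ⊆` closure of its intersection with `Δ^tp_X`" at the genuine 𝔛-datum, and of the
per-level kernels `Ker(Ĵ ↠ Π̂_{𝔾_J})` of Prop. 2.4 (i)).  For a square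

  `F  —q→  G`,   `ι ↓      ↓ j`,   `F̂  —Φ→  Ĝ`,   `Φ ∘ ι = j ∘ q`,

with `ι`, `j` profinite completions (`IsProfiniteCompletion`), `q` a continuous OPEN surjection and `Φ`
continuous:

* `topologicalClosure_map_ker_le_ker` — the closure `K` of `ι(Ker q)` lies in `Ker Φ` (trivial half);
* `ker_le_topologicalClosure_map_ker` — **`Ker Φ ⊆ K`**: `K` is a closed normal subgroup (it is
  normalised by the dense subgroup `ι(F)`), `F̂/K` is profinite, `F → F̂ → F̂/K` kills `Ker q` and so
  descends along the open surjection `q` to a CONTINUOUS `θ : G → F̂/K`, which extends along `j` to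
  `Θ : Ĝ → F̂/K` (`IsProfiniteCompletion.exists_extension`); `Θ ∘ Φ̄ = id` on the dense image of `F` in
  `F̂/K`, hence everywhere, so `Φ̄ : F̂/K → Ĝ` is injective;
* `ker_eq_topologicalClosure_map_ker`, and the set form `ker_subset_closure_range_inter_ker`
  ("`Ker Φ ⊆` closure of `ι(F) ∩ Ker Φ`", the shape of the [IUTchI] Cor. 2.3 (ii) hypothesis).

Classical; Mathlib + the tree's `IsProfiniteCompletion` API only; no definition, no named fact.  Nothing
here takes a side on [IUTchIII] Cor. 3.12.
-/

noncomputable section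

namespace Literature.AnabelianGeometry.SemiGraphs

namespace IsProfiniteCompletion

open _root_.Topology

universe u v w x

variable {F : Type u} [Group F] [TopologicalSpace F]
  {Fhat : Type v} [Group Fhat] [TopologicalSpace Fhat] [IsTopologicalGroup Fhat]
  {G : Type w} [Group G] [TopologicalSpace G]
  {Ghat : Type x} [Group Ghat] [TopologicalSpace Ghat] [IsTopologicalGroup Ghat]
  {ι : F →ₜ* Fhat} {j : G →ₜ* Ghat}

/-- In a profinite completion `ι : F → F̂`, the closure of the image of a NORMAL subgroup `N ⊴ F` is
normal in `F̂`: the set of `g ∈ F̂` conjugating the (closed) closure into itself is closed and contains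
the dense subgroup `ι(F)`. [cite: MochizukiSemiAnbd2006, §6 p.69] -/
theorem normal_topologicalClosure_map (hι : IsProfiniteCompletion ι) (N : Subgroup F) [hN : N.Normal] :
    ((N.map ι.toMonoidHom).topologicalClosure).Normal := by
  set K : Subgroup Fhat := (N.map ι.toMonoidHom).topologicalClosure with hK
  have hKcl : IsClosed (K : Set Fhat) := Subgroup.isClosed_topologicalClosure _
  -- the set of elements conjugating `K` into itself is closed
  have hS : IsClosed {g : Fhat | ∀ k ∈ K, g * k * g⁻¹ ∈ K} := by
    have : {g : Fhat | ∀ k ∈ K, g * k * g⁻¹ ∈ K} =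
        ⋂ k : K, (fun g : Fhat => g * (k : Fhat) * g⁻¹) ⁻¹' (K : Set Fhat) := by
      ext g
      simp only [Set.mem_setOf_eq, Set.mem_iInter, Set.mem_preimage, SetLike.mem_coe, Subtype.forall]
    rw [this]
    exact isClosed_iInter fun k => hKcl.preimage (by fun_prop)
  -- and contains `ι(F)`
  have hιS : ∀ x : F, ι x ∈ {g : Fhat | ∀ k ∈ K, g * k * g⁻¹ ∈ K} := by
    intro x k hk
    have hcont : Continuous fun g : Fhat => ι x * g * (ι x)⁻¹ := by fun_prop
    have himg : (fun g : Fhat => ι x * g * (ι x)⁻¹) '' (N.map ι.toMonoidHom : Set Fhat) ⊆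
        (N.map ι.toMonoidHom : Set Fhat) := by
      rintro _ ⟨_, ⟨n, hn, rfl⟩, rfl⟩
      refine ⟨x * n * x⁻¹, hN.conj_mem n hn x, ?_⟩
      simp only [map_mul, map_inv]
      rfl
    have hk' : (k : Fhat) ∈ closure (N.map ι.toMonoidHom : Set Fhat) := by
      rw [← Subgroup.topologicalClosure_coe]; exact hk
    have h2 : ι x * k * (ι x)⁻¹ ∈ closure ((fun g : Fhat => ι x * g * (ι x)⁻¹) ''
        (N.map ι.toMonoidHom : Set Fhat)) :=
      image_closure_subset_closure_image hcont ⟨k, hk', rfl⟩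
    show ι x * k * (ι x)⁻¹ ∈ K
    rw [← SetLike.mem_coe, hK, Subgroup.topologicalClosure_coe]
    exact closure_mono himg h2
  have hall : ∀ g : Fhat, g ∈ {g : Fhat | ∀ k ∈ K, g * k * g⁻¹ ∈ K} := fun g =>
    hS.closure_subset_iff.2 (Set.range_subset_iff.2 hιS) (by rw [hι.denseRange.closure_range]; trivial)
  exact ⟨fun k hk g => hall g k hk⟩

omit [IsTopologicalGroup Ghat] in
/-- The trivial half: for a square `Φ ∘ ι = j ∘ q` into a Hausdorff `Ĝ`, the closure of `ι(Ker q)` lies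
in `Ker Φ`. [cite: MochizukiSemiAnbd2006, §6 p.69] -/
theorem topologicalClosure_map_ker_le_ker [T2Space Ghat] (q : F →ₜ* G) (Φ : Fhat →ₜ* Ghat)
    (hΦ : ∀ x, Φ (ι x) = j (q x)) :
    (q.toMonoidHom.ker.map ι.toMonoidHom).topologicalClosure ≤ Φ.toMonoidHom.ker := by
  refine Subgroup.topologicalClosure_minimal _ ?_ ?_
  · rintro _ ⟨x, hx, rfl⟩
    have hx' : q x = 1 := hx
    rw [MonoidHom.mem_ker]
    change Φ (ι x) = 1
    rw [hΦ, hx', map_one]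
  · have h1 : IsClosed ((Φ : Fhat → Ghat) ⁻¹' {1}) := isClosed_singleton.preimage Φ.continuous
    convert h1 using 1
    ext g
    simp only [SetLike.mem_coe, MonoidHom.mem_ker, Set.mem_preimage, Set.mem_singleton_iff]
    rfl

/-- **The kernel of a completed open surjection is the closure of the image of the kernel**
(right exactness of profinite completion, in the `IsProfiniteCompletion` interface): for `ι : F → F̂`,
`j : G → Ĝ` profinite completions, `q : F ↠ G` a continuous open surjection and `Φ : F̂ → Ĝ` continuous
with `Φ ∘ ι = j ∘ q`, one has `Ker Φ ⊆` the closure of `ι(Ker q)`.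
[cite: RibesZalesskii2010, Prop 3.2.5] -/
theorem ker_le_topologicalClosure_map_ker (hι : IsProfiniteCompletion ι) (hj : IsProfiniteCompletion j)
    (q : F →ₜ* G) (hq : Function.Surjective q) (hqo : IsOpenMap q)
    (Φ : Fhat →ₜ* Ghat) (hΦ : ∀ x, Φ (ι x) = j (q x)) :
    Φ.toMonoidHom.ker ≤ (q.toMonoidHom.ker.map ι.toMonoidHom).topologicalClosure := by
  classical
  haveI : CompactSpace Fhat := hι.compactSpace
  haveI : T2Space Fhat := hι.t2Space
  haveI : TotallyDisconnectedSpace Fhat := hι.totallyDisconnectedSpace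
  haveI : T2Space Ghat := hj.t2Space
  -- the closed normal subgroup `K` and the profinite quotient `F̂ ⧸ K`
  set K : Subgroup Fhat := (q.toMonoidHom.ker.map ι.toMonoidHom).topologicalClosure with hKdef
  haveI hKn : K.Normal := normal_topologicalClosure_map hι q.toMonoidHom.ker
  have hKcl : IsClosed (K : Set Fhat) := Subgroup.isClosed_topologicalClosure _
  haveI : IsClosed (K : Set Fhat) := hKcl
  haveI : TotallyDisconnectedSpace (Fhat ⧸ K) :=
    Literature.GroupTheory.ProfiniteSubquotients.totallyDisconnectedSpace_quotient K hKcl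
  let mk : Fhat →* Fhat ⧸ K := QuotientGroup.mk' K
  have hmk : Continuous mk := QuotientGroup.continuous_mk
  -- `θ₀ := mk ∘ ι : F → F̂ ⧸ K` kills `Ker q`
  let θ₀ : F →* Fhat ⧸ K := mk.comp ι.toMonoidHom
  have hθ₀c : Continuous θ₀ := hmk.comp ι.continuous
  have hθ₀ker : q.toMonoidHom.ker ≤ θ₀.ker := by
    intro n hn
    rw [MonoidHom.mem_ker]
    change mk (ι n) = 1
    rw [QuotientGroup.mk'_apply, QuotientGroup.eq_one_iff]
    exact Subgroup.le_topologicalClosure _ ⟨n, hn, rfl⟩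
  -- so it descends along the open surjection `q` to a continuous `θ : G → F̂ ⧸ K`
  let θ : G →* Fhat ⧸ K := q.toMonoidHom.liftOfSurjective hq ⟨θ₀, hθ₀ker⟩
  have hθq : ∀ x : F, θ (q x) = θ₀ x := fun x =>
    q.toMonoidHom.liftOfRightInverse_comp_apply _ _ ⟨θ₀, hθ₀ker⟩ x
  have hθc : Continuous θ := by
    have hqm : IsQuotientMap q := hqo.isQuotientMap q.continuous hq
    rw [hqm.continuous_iff]
    have : (θ : G → Fhat ⧸ K) ∘ q = θ₀ := funext fun x => hθq x
    rw [this]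
    exact hθ₀c
  let θc : G →ₜ* Fhat ⧸ K := { toMonoidHom := θ, continuous_toFun := hθc }
  -- which extends along `j` to `Θ : Ĝ → F̂ ⧸ K`
  obtain ⟨Θ, hΘ⟩ := hj.exists_extension θc
  -- `Φ̄ : F̂ ⧸ K → Ĝ`
  have hKΦ : K ≤ Φ.toMonoidHom.ker := topologicalClosure_map_ker_le_ker q Φ hΦ
  let Φbar : Fhat ⧸ K →* Ghat := QuotientGroup.lift K Φ.toMonoidHom hKΦ
  have hΦbar_c : Continuous Φbar := by
    rw [(QuotientGroup.isQuotientMap_mk K).continuous_iff]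
    exact Φ.continuous
  -- `Θ ∘ Φ̄ = id` (on the dense image of `F`, hence everywhere)
  have hd : DenseRange θ₀ := (QuotientGroup.mk'_surjective K).denseRange.comp hι.denseRange hmk
  have hcomp : (fun y : Fhat ⧸ K => Θ (Φbar y)) = id := by
    refine Continuous.ext_on hd (Θ.continuous.comp hΦbar_c) continuous_id ?_
    rintro _ ⟨x, rfl⟩
    change Θ (Φbar (mk (ι x))) = mk (ι x)
    rw [QuotientGroup.mk'_apply, QuotientGroup.lift_mk]
    change Θ (Φ (ι x)) = _
    rw [hΦ, hΘ]
    change θ (q x) = _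
    rw [hθq]
    rfl
  -- conclusion: `Φ z = 1 ⇒ Φ̄ [z] = 1 ⇒ [z] = Θ 1 = 1 ⇒ z ∈ K`
  intro z hz
  rw [MonoidHom.mem_ker] at hz
  have h1 : Φbar (mk z) = 1 := by
    rw [QuotientGroup.mk'_apply, QuotientGroup.lift_mk]
    exact hz
  have h2 : mk z = 1 := by
    have := congrFun hcomp (mk z)
    simp only [id] at this
    rw [← this, h1, map_one]
  rw [QuotientGroup.mk'_apply, QuotientGroup.eq_one_iff] at h2
  exact h2

/-- **`Ker Φ =` the closure of `ι(Ker q)`** (both halves). [cite: RibesZalesskii2010, Prop 3.2.5] -/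
theorem ker_eq_topologicalClosure_map_ker (hι : IsProfiniteCompletion ι) (hj : IsProfiniteCompletion j)
    (q : F →ₜ* G) (hq : Function.Surjective q) (hqo : IsOpenMap q)
    (Φ : Fhat →ₜ* Ghat) (hΦ : ∀ x, Φ (ι x) = j (q x)) :
    Φ.toMonoidHom.ker = (q.toMonoidHom.ker.map ι.toMonoidHom).topologicalClosure := by
  haveI : T2Space Ghat := hj.t2Space
  exact le_antisymm (ker_le_topologicalClosure_map_ker hι hj q hq hqo Φ hΦ)
    (topologicalClosure_map_ker_le_ker q Φ hΦ)

/-- Set form, the shape of the [IUTchI] Cor. 2.3 (ii) interface hypothesis: **`Ker Φ ⊆` the closure of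
`ι(F) ∩ Ker Φ`** ("the kernel of `Δ̂_X ↠ Π̂_𝔾` is the closure of its intersection with `Δ^tp_X`").
[cite: MochizukiSemiAnbd2006, Ex 3.10 p.45] -/
theorem ker_subset_closure_range_inter_ker (hι : IsProfiniteCompletion ι) (hj : IsProfiniteCompletion j)
    (q : F →ₜ* G) (hq : Function.Surjective q) (hqo : IsOpenMap q)
    (Φ : Fhat →ₜ* Ghat) (hΦ : ∀ x, Φ (ι x) = j (q x)) :
    (Φ.toMonoidHom.ker : Set Fhat) ⊆
      closure (Set.range ι ∩ (Φ.toMonoidHom.ker : Set Fhat)) := by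
  intro z hz
  have h := ker_le_topologicalClosure_map_ker hι hj q hq hqo Φ hΦ hz
  rw [← SetLike.mem_coe, Subgroup.topologicalClosure_coe] at h
  refine closure_mono ?_ h
  rintro _ ⟨x, hx, rfl⟩
  have hx' : q x = 1 := hx
  refine ⟨⟨x, rfl⟩, ?_⟩
  rw [SetLike.mem_coe, MonoidHom.mem_ker]
  change Φ (ι x) = 1
  rw [hΦ, hx', map_one]

end IsProfiniteCompletion

end Literature.AnabelianGeometry.SemiGraphs

end
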